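import Summits.ABC.IUTFork.Cor312LicenceTripleUnconditionalSlot
import Summits.ABC.IUTFork.Conditional.WRowUnconditionalCellsSlot
import Summits.ABC.IUTFork.Conditional.WRowReyssatAllLevels
import HarnessLib

/-!
# R-W WINDOW-TABLE «W:INHABITED-BANDS-A» — Reyssat's triple `2 + 3¹⁰·109 = 23⁵` at the three remaining open levels `l = 151, 157, 163`:
# the hull licence S_H HOLDS at EVERY genuine Θ-volume datum over `(ratPoint (2/6436343), l)`, unconditionally

PROOF-ONLY file (D-0012; 0 definitions, 0 `Prop` facts) of the abc-iut cell — D-0079 RESCUE sub-cell R-W «WINDOW Θ-SIDE INEQUALITY», W1 ROW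
DECISIONS composer seat abc-iut-W-row-1 (gen 2), claim «W:INHABITED-BANDS-A» (abc-iut-plan ruling C-R75). Companion of `WRowReyssatAllLevels`
(`WRow.licence_reyssat_all`, every prime `l ≥ 167`): at `l = 151, 157, 163` the tame prime `23` (`e ∈ 6l·ℕ` by abc-iut-w4-d107's twist) does
NOT close with the volume witness `ρin = 1` — the end-label quadratic `−6L² + 487L + 486` is positive below `L = 83` — but it DOES close with
abc-iut-c312-5's integer slot `ρin = ⌊e/22⌋` (valid in every `ℚ₂₃`-field): this seat's slot variant of the socket
(`WRow.licence_triple_unconditional_slot`, `Cor312LicenceTripleUnconditionalSlot`) with `WRow.cell_tameslot_of_ends` (`⌊e₀n/22⌋ ≥ r·n`,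
`r = 41, 42, 44`). At `l = 151` even that floor-free cell misses at the base multiple (by `221`), while the EXACT cell holds (margin `596`): the
base multiple `n = 1` is decided label by label by the kernel (`decide +kernel`, 75 cells) and every `n ≥ 2` from the floor-free cell at `n = 2`.
TAKES NO SIDE on [IUTchIII] Cor. 3.12 (S. Mochizuki, *Inter-universal Teichmüller theory III*, Cor. 3.12 p. 173–174; Step (xi-f) p. 184) or on
any author; «inhabited as typed» ≠ «asserted in print».

WHAT IS PROVED (namespace `Summit.ABC.IUTFork.Conditional`): `WRow.hcell_reyssat_small` (the arithmetic at `l ∈ {151, 157, 163}`), **`WRow.licence_reyssat_small`** — for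
`l ∈ {151, 157, 163}`, EVERY genuine Θ-volume datum `T` at `(ratPoint (2/6436343), l)` and EVERY pair of realising Θ- and q-ideles, abc-iut-c312-1's
`Thm311ToCor312.Licence` HOLDS at `settingPrVolSharp (pilotDataOfK T.D T.K) …`; **`WRow.exists_qPinned_and_hull_reyssat_small`** — branch C's «∃ ρ qK, QPinned ∧
PilotKummerCompatHull» there, any columns. With `WRow.licence_reyssat_all` ALL 43 open Reyssat rows of HOME/plan/rescue/R-W/OPEN-INHABITED-ROUTE.tsv
(`151 ≤ l ≤ 293`) are decided on the inhabited side. READING (neutral): no number-level and no local-type hypothesis is consumed; admissibility /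
(P6) / Szpiro-badness and NON-EMPTINESS of the datum type are NOT claimed. HONEST SCOPE: OUR sharp containers; STRONGER-THAN-PRINT hull reading;
nothing about the printed inequality or any author's intended hull; typed ≠ proved; instantiated ≠ endorsed; no abc claim.
[cite: Mochizuki2012, IUTchI Def. 3.1 (b),(c) pp. 61–62, Rmk. 3.1.5 p. 65, Ex. 3.2 (iv) p. 71; IUTchIII Cor. 3.12 Step (xi-f) p. 184; IUTchIV Prop. 1.1 p. 9, Prop. 1.2 (i)(ii) p. 10, Prop. 1.4 (ii) p. 13, Cor. 2.2 (ii) proof (P5) p. 46]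
[cite: DupuyHilado2025, §3.3, §3.4, §4.9, §4.12] [cite: NeukirchANT1999, Ch. II (5.5)–(5.7)] [claim: Mochizuki2012, status: disputed] for every IUT sentence.
-/

noncomputable section

open Set Function Metric NumberField IsDedekindDomain

namespace Summit.ABC.IUTFork.Conditional

open Thm311 Thm311.Real Cor312 Cor312Vol Cor312Prov Literature.IUT.LogThetaLattice Literature.IUT.LogVolume
  Literature.IUT.HodgeTheaters Literature.IUT.LogVolume.Cor22
open Literature.NumberTheory.NumberFields Literature.NumberTheory.GaloisRepresentations.Ultrametric
open Literature.NumberTheory.DiophantineGeometry Literature.NumberTheory.DiophantineGeometry.GenEll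

/-! ## The arithmetic at `l = 151, 157, 163` (slot form) -/

/-- **The slot socket's arithmetic hypothesis for Reyssat's triple at `l ∈ {151, 157, 163}`**: `e ∈ 6l·ℕ` at `3` (wild, `D = 2e−1`, `A = 4`),
`15l·ℕ` at `109` (`A = 0`), `6l·ℕ` at `23` (twist; `A = 2`, slot `⌊e/22⌋ ≥ r·n`); end-label base cells by `norm_num`, the base multiple at
`(l, p) = (151, 23)` exactly by `decide +kernel`. [folklore] -/
theorem WRow.hcell_reyssat_small {l : ℕ} (hl : l = 151 ∨ l = 157 ∨ l = 163) :
    ∀ p : ℕ, p.Prime → p ∣ 2 * 6436341 * 6436343 → p ≠ 2 → p ≠ l → ∀ e : ℕ, 0 < e → l ∣ e →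
      15 * l ∣ e * (2 * 6436341 * 6436343).factorization p → (p ∣ 30 → (p - 1) ∣ e) →
      (p ∣ 6436343 → Odd ((2 * 6436341 * 6436343).factorization p) → 30 * l ∣ e * (2 * 6436341 * 6436343).factorization p) →
      (∀ k : ℕ, (e : ℤ) ≠ (p : ℤ) ^ k * ((p : ℤ) - 1)) ∧
      ∀ i : ℕ, i < (l - 1) / 2 →
        (e : ℤ) * ((((i + 1 : ℕ) : ℤ) ^ 2 * ((e * (2 * (2 * 6436341 * 6436343).factorization p) / (2 * l) : ℕ) : ℤ) -
            ((i + 1 : ℕ) : ℤ) * (((if p ∣ 30 ∧ ¬ p ∣ (2 * 6436341 * 6436343).factorization p then 2 * e - 1 else e - 1 : ℕ) : ℕ) : ℤ) -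
            ((i + 2 : ℕ) : ℤ) * ((((max 1 (e / (p - 1))) : ℕ) : ℤ))) / (e : ℤ)) +
          ((i + 2 : ℕ) : ℤ) * min ((p : ℤ) ^ (if p = 3 then 4 else if p = 109 then 0 else 2) - ((if p = 3 then 4 else if p = 109 then 0 else 2 : ℕ) : ℤ) * (e : ℤ))
            ((p : ℤ) ^ (if p = 3 then 5 else if p = 109 then 1 else 1) - ((if p = 3 then 5 else if p = 109 then 1 else 1 : ℕ) : ℤ) * (e : ℤ)) ≤
        ((e * (2 * (2 * 6436341 * 6436343).factorization p) / (2 * l) : ℕ) : ℤ) := by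
  intro p hp hpabc h2 hpl e he _hle h15 h30 hodd
  rcases hl with rfl | rfl | rfl <;> rcases eq_of_prime_dvd_triple_reyssat hp hpabc with rfl | rfl | rfl | rfl
  · exact absurd rfl h2
  · -- `l = 151`, `p = 3`: `e = 906·n`, `A = 4`
    rw [factorization_triple_reyssat.1] at h15 hodd ⊢
    norm_num at h15
    rw [show (2265 : ℕ) = 453 * 5 by norm_num, show e * 10 = e * 2 * 5 by ring] at h15
    have hm : 453 ∣ e := Nat.Coprime.dvd_of_dvd_mul_right (by norm_num : Nat.Coprime 453 2) (Nat.dvd_of_mul_dvd_mul_right (by norm_num) h15)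
    have hpe : 2 ∣ e := by have := h30 (by norm_num); norm_num at this; exact this
    have he0 : 906 ∣ e := by
      have := Nat.Coprime.mul_dvd_of_dvd_of_dvd (by norm_num : Nat.Coprime 453 2) hm hpe
      rwa [show (453 : ℕ) * 2 = 906 by norm_num] at this
    obtain ⟨n, rfl⟩ := he0
    have hn : 1 ≤ n := by omega
    refine ⟨WRow.natCast_ne_pow_mul_sub_one (by norm_num : Nat.Prime 151) (by norm_num) (by norm_num) (by norm_num) ⟨6 * n, by ring⟩,
      fun i hi => ?_⟩
    rw [if_pos ⟨by norm_num, by norm_num⟩, max_eq_right (show 1 ≤ 906 * n / (3 - 1) by omega)]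
    simp only [ite_true]
    refine WRow.cell_wild_of_ends ((3 : ℕ) : ℤ) 906 (3 - 1) (2 * 10) (2 * 151) 4 5 75 (by norm_num) (by norm_num) (by norm_num) (by norm_num)
      (by norm_num) (by norm_num) ?_ hi hn
    rintro i (rfl | hi')
    · norm_num
    · obtain rfl : i = 74 := by omega
      norm_num
  · -- `l = 151`, `p = 109`: `e = 2265·n`, `A = 0`, slot `⌊e/108⌋ ≥ 20·n`
    rw [factorization_triple_reyssat.2.1] at h15 hodd ⊢
    norm_num at h15
    obtain ⟨n, rfl⟩ := h15
    have hn : 1 ≤ n := by omega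
    refine ⟨WRow.natCast_ne_pow_mul_sub_one (by norm_num : Nat.Prime 5) (by norm_num) (by norm_num) (by norm_num) ⟨453 * n, by ring⟩,
      fun i hi => ?_⟩
    rw [if_neg (by norm_num : ¬ ((109 : ℕ) ∣ 30 ∧ ¬ (109 : ℕ) ∣ 1))]
    simp only [show ((109 : ℕ) = 3) = False from eq_false (by decide), ite_true, ite_false]
    refine WRow.cell_tameslot_of_ends ((109 : ℕ) : ℤ) 2265 (109 - 1) 20 (2 * 1) (2 * 151) 0 1 75 1 (by norm_num) (by norm_num) (by norm_num)
      (by norm_num) (by norm_num) (by norm_num) le_rfl ?_ hi hn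
    rintro i (rfl | hi')
    · norm_num
    · obtain rfl : i = 74 := by omega
      norm_num
  · -- `l = 151`, `p = 23`: `e = 906·n` (twist), `A = 2`, slot `⌊e/22⌋ ≥ 41·n`
    rw [factorization_triple_reyssat.2.2] at h15 hodd ⊢
    have hT := hodd (by norm_num) (by decide)
    norm_num at hT
    rw [show (4530 : ℕ) = 906 * 5 by norm_num] at hT
    obtain ⟨n, rfl⟩ := Nat.dvd_of_mul_dvd_mul_right (by norm_num) hT
    have hn : 1 ≤ n := by omega
    refine ⟨WRow.natCast_ne_pow_mul_sub_one (by norm_num : Nat.Prime 3) (by norm_num) (by norm_num) (by norm_num) ⟨302 * n, by ring⟩,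
      fun i hi => ?_⟩
    rw [if_neg (by norm_num : ¬ ((23 : ℕ) ∣ 30 ∧ ¬ (23 : ℕ) ∣ 5))]
    simp only [show ((23 : ℕ) = 3) = False from eq_false (by decide), show ((23 : ℕ) = 109) = False from eq_false (by decide), ite_false]
    rcases Nat.lt_or_ge n 2 with hn2 | hn2
    · obtain rfl : n = 1 := by omega
      norm_num at hi
      interval_cases i <;> decide +kernel
    · refine WRow.cell_tameslot_of_ends ((23 : ℕ) : ℤ) 906 (23 - 1) 41 (2 * 5) (2 * 151) 2 1 75 2 (by norm_num) (by norm_num) (by norm_num)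
        (by norm_num) (by norm_num) (by norm_num) (by norm_num) ?_ hi hn2
      rintro i (rfl | hi')
      · norm_num
      · obtain rfl : i = 74 := by omega
        norm_num
  · exact absurd rfl h2
  · -- `l = 157`, `p = 3`: `e = 942·n`, `A = 4`
    rw [factorization_triple_reyssat.1] at h15 hodd ⊢
    norm_num at h15
    rw [show (2355 : ℕ) = 471 * 5 by norm_num, show e * 10 = e * 2 * 5 by ring] at h15
    have hm : 471 ∣ e := Nat.Coprime.dvd_of_dvd_mul_right (by norm_num : Nat.Coprime 471 2) (Nat.dvd_of_mul_dvd_mul_right (by norm_num) h15)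
    have hpe : 2 ∣ e := by have := h30 (by norm_num); norm_num at this; exact this
    have he0 : 942 ∣ e := by
      have := Nat.Coprime.mul_dvd_of_dvd_of_dvd (by norm_num : Nat.Coprime 471 2) hm hpe
      rwa [show (471 : ℕ) * 2 = 942 by norm_num] at this
    obtain ⟨n, rfl⟩ := he0
    have hn : 1 ≤ n := by omega
    refine ⟨WRow.natCast_ne_pow_mul_sub_one (by norm_num : Nat.Prime 157) (by norm_num) (by norm_num) (by norm_num) ⟨6 * n, by ring⟩,
      fun i hi => ?_⟩
    rw [if_pos ⟨by norm_num, by norm_num⟩, max_eq_right (show 1 ≤ 942 * n / (3 - 1) by omega)]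
    simp only [ite_true]
    refine WRow.cell_wild_of_ends ((3 : ℕ) : ℤ) 942 (3 - 1) (2 * 10) (2 * 157) 4 5 78 (by norm_num) (by norm_num) (by norm_num) (by norm_num)
      (by norm_num) (by norm_num) ?_ hi hn
    rintro i (rfl | hi')
    · norm_num
    · obtain rfl : i = 77 := by omega
      norm_num
  · -- `l = 157`, `p = 109`: `e = 2355·n`, `A = 0`, slot `⌊e/108⌋ ≥ 21·n`
    rw [factorization_triple_reyssat.2.1] at h15 hodd ⊢
    norm_num at h15
    obtain ⟨n, rfl⟩ := h15
    have hn : 1 ≤ n := by omega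
    refine ⟨WRow.natCast_ne_pow_mul_sub_one (by norm_num : Nat.Prime 5) (by norm_num) (by norm_num) (by norm_num) ⟨471 * n, by ring⟩,
      fun i hi => ?_⟩
    rw [if_neg (by norm_num : ¬ ((109 : ℕ) ∣ 30 ∧ ¬ (109 : ℕ) ∣ 1))]
    simp only [show ((109 : ℕ) = 3) = False from eq_false (by decide), ite_true, ite_false]
    refine WRow.cell_tameslot_of_ends ((109 : ℕ) : ℤ) 2355 (109 - 1) 21 (2 * 1) (2 * 157) 0 1 78 1 (by norm_num) (by norm_num) (by norm_num)
      (by norm_num) (by norm_num) (by norm_num) le_rfl ?_ hi hn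
    rintro i (rfl | hi')
    · norm_num
    · obtain rfl : i = 77 := by omega
      norm_num
  · -- `l = 157`, `p = 23`: `e = 942·n` (twist), `A = 2`, slot `⌊e/22⌋ ≥ 42·n`
    rw [factorization_triple_reyssat.2.2] at h15 hodd ⊢
    have hT := hodd (by norm_num) (by decide)
    norm_num at hT
    rw [show (4710 : ℕ) = 942 * 5 by norm_num] at hT
    obtain ⟨n, rfl⟩ := Nat.dvd_of_mul_dvd_mul_right (by norm_num) hT
    have hn : 1 ≤ n := by omega
    refine ⟨WRow.natCast_ne_pow_mul_sub_one (by norm_num : Nat.Prime 3) (by norm_num) (by norm_num) (by norm_num) ⟨314 * n, by ring⟩,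
      fun i hi => ?_⟩
    rw [if_neg (by norm_num : ¬ ((23 : ℕ) ∣ 30 ∧ ¬ (23 : ℕ) ∣ 5))]
    simp only [show ((23 : ℕ) = 3) = False from eq_false (by decide), show ((23 : ℕ) = 109) = False from eq_false (by decide), ite_false]
    refine WRow.cell_tameslot_of_ends ((23 : ℕ) : ℤ) 942 (23 - 1) 42 (2 * 5) (2 * 157) 2 1 78 1 (by norm_num) (by norm_num) (by norm_num)
      (by norm_num) (by norm_num) (by norm_num) le_rfl ?_ hi hn
    rintro i (rfl | hi')
    · norm_num
    · obtain rfl : i = 77 := by omega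
      norm_num
  · exact absurd rfl h2
  · -- `l = 163`, `p = 3`: `e = 978·n`, `A = 4`
    rw [factorization_triple_reyssat.1] at h15 hodd ⊢
    norm_num at h15
    rw [show (2445 : ℕ) = 489 * 5 by norm_num, show e * 10 = e * 2 * 5 by ring] at h15
    have hm : 489 ∣ e := Nat.Coprime.dvd_of_dvd_mul_right (by norm_num : Nat.Coprime 489 2) (Nat.dvd_of_mul_dvd_mul_right (by norm_num) h15)
    have hpe : 2 ∣ e := by have := h30 (by norm_num); norm_num at this; exact this
    have he0 : 978 ∣ e := by
      have := Nat.Coprime.mul_dvd_of_dvd_of_dvd (by norm_num : Nat.Coprime 489 2) hm hpe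
      rwa [show (489 : ℕ) * 2 = 978 by norm_num] at this
    obtain ⟨n, rfl⟩ := he0
    have hn : 1 ≤ n := by omega
    refine ⟨WRow.natCast_ne_pow_mul_sub_one (by norm_num : Nat.Prime 163) (by norm_num) (by norm_num) (by norm_num) ⟨6 * n, by ring⟩,
      fun i hi => ?_⟩
    rw [if_pos ⟨by norm_num, by norm_num⟩, max_eq_right (show 1 ≤ 978 * n / (3 - 1) by omega)]
    simp only [ite_true]
    refine WRow.cell_wild_of_ends ((3 : ℕ) : ℤ) 978 (3 - 1) (2 * 10) (2 * 163) 4 5 81 (by norm_num) (by norm_num) (by norm_num) (by norm_num)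
      (by norm_num) (by norm_num) ?_ hi hn
    rintro i (rfl | hi')
    · norm_num
    · obtain rfl : i = 80 := by omega
      norm_num
  · -- `l = 163`, `p = 109`: `e = 2445·n`, `A = 0`, slot `⌊e/108⌋ ≥ 22·n`
    rw [factorization_triple_reyssat.2.1] at h15 hodd ⊢
    norm_num at h15
    obtain ⟨n, rfl⟩ := h15
    have hn : 1 ≤ n := by omega
    refine ⟨WRow.natCast_ne_pow_mul_sub_one (by norm_num : Nat.Prime 5) (by norm_num) (by norm_num) (by norm_num) ⟨489 * n, by ring⟩,
      fun i hi => ?_⟩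
    rw [if_neg (by norm_num : ¬ ((109 : ℕ) ∣ 30 ∧ ¬ (109 : ℕ) ∣ 1))]
    simp only [show ((109 : ℕ) = 3) = False from eq_false (by decide), ite_true, ite_false]
    refine WRow.cell_tameslot_of_ends ((109 : ℕ) : ℤ) 2445 (109 - 1) 22 (2 * 1) (2 * 163) 0 1 81 1 (by norm_num) (by norm_num) (by norm_num)
      (by norm_num) (by norm_num) (by norm_num) le_rfl ?_ hi hn
    rintro i (rfl | hi')
    · norm_num
    · obtain rfl : i = 80 := by omega
      norm_num
  · -- `l = 163`, `p = 23`: `e = 978·n` (twist), `A = 2`, slot `⌊e/22⌋ ≥ 44·n`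
    rw [factorization_triple_reyssat.2.2] at h15 hodd ⊢
    have hT := hodd (by norm_num) (by decide)
    norm_num at hT
    rw [show (4890 : ℕ) = 978 * 5 by norm_num] at hT
    obtain ⟨n, rfl⟩ := Nat.dvd_of_mul_dvd_mul_right (by norm_num) hT
    have hn : 1 ≤ n := by omega
    refine ⟨WRow.natCast_ne_pow_mul_sub_one (by norm_num : Nat.Prime 3) (by norm_num) (by norm_num) (by norm_num) ⟨326 * n, by ring⟩,
      fun i hi => ?_⟩
    rw [if_neg (by norm_num : ¬ ((23 : ℕ) ∣ 30 ∧ ¬ (23 : ℕ) ∣ 5))]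
    simp only [show ((23 : ℕ) = 3) = False from eq_false (by decide), show ((23 : ℕ) = 109) = False from eq_false (by decide), ite_false]
    refine WRow.cell_tameslot_of_ends ((23 : ℕ) : ℤ) 978 (23 - 1) 44 (2 * 5) (2 * 163) 2 1 81 1 (by norm_num) (by norm_num) (by norm_num)
      (by norm_num) (by norm_num) (by norm_num) le_rfl ?_ hi hn
    rintro i (rfl | hi')
    · norm_num
    · obtain rfl : i = 80 := by omega
      norm_num

/-! ## THE ROWS: S_H INHABITED at every genuine datum over `(ratPoint (2/6436343), l)`, `l = 151, 157, 163` -/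

/-- **«W:INHABITED-BANDS-A», Reyssat `2 + 3¹⁰·109 = 23⁵` at `l ∈ {151, 157, 163}`**: for every genuine Θ-volume datum `T` at `(ratPoint (2/6436343), l)`
([IUTchIV] Cor. 2.2 (ii) proof (P7)) and every pair of Θ- and q-ideles realising the pilot divisors of `X := pilotDataOfK T.D T.K`, abc-iut-c312-1's
`Thm311ToCor312.Licence` HOLDS at abc-iut-c312-7's `settingPrVolSharp X …` — the slot socket `WRow.licence_triple_unconditional_slot` at `WRow.hcell_reyssat_small`.
[cite: Mochizuki2012, IUTchI Def. 3.1 (b),(c) pp. 61–62, Rmk. 3.1.5 p. 65, Ex. 3.2 (iv) p. 71; IUTchIII Cor. 3.12 Step (xi-f) p. 184; IUTchIV Prop. 1.1 p. 9, Prop. 1.2 (i)(ii) p. 10, Prop. 1.4 (ii) p. 13, Cor. 2.2 (ii) proof (P5) p. 46] [cite: DupuyHilado2025, §3.3, §3.4, §4.9, §4.12] [claim: Mochizuki2012, status: disputed] -/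
theorem WRow.licence_reyssat_small (l : ℕ) (hl : l = 151 ∨ l = 157 ∨ l = 163) (T : Cor22.ThetaVolumeDatumAt (ratPoint (((2 : ℕ) : ℚ) / (6436343 : ℕ))) l) :
    letI := T.instFieldF; letI := T.instNumberFieldF; letI := T.instAlgebraF; letI := T.instFieldK
    letI := T.instNumberFieldK; letI := T.instAlgebraK; letI := T.instFieldFbar; letI := T.instAlgebraFbar
    letI := T.instAlgebraKFbar; letI := T.instIsElliptic
    ∀ {logv : PadicLogs T.K} (hlog : LogvAnalytic logv) (M : Type) [Field M] [NumberField M]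
      (archPk : ∀ (j : (thetaIndex (pilotDataOfK T.D T.K)).Label) (vQ : (thetaIndex (pilotDataOfK T.D T.K)).VQ),
        Set ((logShellsDH (pilotDataOfK T.D T.K) logv).Packet j vQ))
      (archSub : ∀ (j : (thetaIndex (pilotDataOfK T.D T.K)).Label) (v : (thetaIndex (pilotDataOfK T.D T.K)).V),
        Set ((logShellsDH (pilotDataOfK T.D T.K) logv).Packet j ((thetaIndex (pilotDataOfK T.D T.K)).over v)))
      (Ψ : ℤ → ∀ v : (thetaIndex (pilotDataOfK T.D T.K)).V, v ∈ (thetaIndex (pilotDataOfK T.D T.K)).Vbad →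
        Set ((logShellsDH (pilotDataOfK T.D T.K) logv).StarPacket v))
      (act : ℤ → ∀ v : (thetaIndex (pilotDataOfK T.D T.K)).V, v ∈ (thetaIndex (pilotDataOfK T.D T.K)).Vbad →
        (logShellsDH (pilotDataOfK T.D T.K) logv).StarPacket v → Module.End ℚ ((logShellsDH (pilotDataOfK T.D T.K) logv).StarPacket v))
      (Mmod : ℤ → ∀ j : (thetaIndex (pilotDataOfK T.D T.K)).LabelStar, Set ((logShellsDH (pilotDataOfK T.D T.K) logv).GlobalPacket j.1))
      (region : ℤ → ∀ j : (thetaIndex (pilotDataOfK T.D T.K)).LabelStar, FinDivisor M → ∀ vQ : (thetaIndex (pilotDataOfK T.D T.K)).VQ,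
        Set ((logShellsDH (pilotDataOfK T.D T.K) logv).Packet j.1 vQ))
      (n : ℤ) {HT : Type} {LogLink : HT → HT → Type} {IsFull : ∀ {s t : HT}, LogLink s t → Prop}
      (lat : LGPGaussianLogThetaLattice LogLink IsFull)
      {Frd : Type} {IsoF : Frd → Frd → Type} {Ob : Frd → Type} {realify : Frd → Frd} {Strip : Type}
      {IsoS : Strip → Strip → Type} {Mv : ∀ v : (thetaIndex (pilotDataOfK T.D T.K)).V, v ∈ (thetaIndex (pilotDataOfK T.D T.K)).Vbad → Type}
      [∀ v h, Monoid (Mv v h)]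
      (sig : GlobalLGPFrobenioidSignature (thetaIndex (pilotDataOfK T.D T.K)).lstar (thetaIndex (pilotDataOfK T.D T.K)).V
        (· ∈ (thetaIndex (pilotDataOfK T.D T.K)).Vbad) Frd IsoF Ob realify Strip IsoS Mv)
      (split : SplittingMonoids Mv) {ObΔ : Type} {N : ∀ v : (thetaIndex (pilotDataOfK T.D T.K)).V, v ∈ (thetaIndex (pilotDataOfK T.D T.K)).Vbad → Type}
      [∀ v h, Monoid (N v h)] (qData : QPilotData ObΔ N)
      (tq : ∀ (pp : Nat.Primes) (x : (thetaIndex (pilotDataOfK T.D T.K)).Fibre (.inr pp)),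
        haveI : Fact (pp : ℕ).Prime := ⟨pp.2⟩; kOf (pilotDataOfK T.D T.K) pp.1 x)
      (t : ∀ (pp : Nat.Primes) (_ : Fin (pilotDataOfK T.D T.K).lstar) (x : (thetaIndex (pilotDataOfK T.D T.K)).Fibre (.inr pp)),
        haveI : Fact (pp : ℕ).Prime := ⟨pp.2⟩; kOf (pilotDataOfK T.D T.K) pp.1 x)
      (htq0 : ∀ pp x, tq pp x ≠ 0)
      (htq1 : ∀ (pp : Nat.Primes) (x : (thetaIndex (pilotDataOfK T.D T.K)).Fibre (.inr pp)),
        haveI : Fact (pp : ℕ).Prime := ⟨pp.2⟩; placeOf (pilotDataOfK T.D T.K) pp.1 x ∉ (pilotDataOfK T.D T.K).S → ‖tq pp x‖ = 1)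
      (_ht0 : ∀ pp i x, t pp i x ≠ 0)
      (_ht : ∀ (pp : Nat.Primes) (i : Fin (pilotDataOfK T.D T.K).lstar) (x : (thetaIndex (pilotDataOfK T.D T.K)).Fibre (.inr pp)),
        haveI : Fact (pp : ℕ).Prime := ⟨pp.2⟩
        Real.log ‖t pp i x‖ = -((pilotDataOfK T.D T.K).thetaPilot i (placeOf (pilotDataOfK T.D T.K) pp.1 x)) *
          logNorm T.K (placeOf (pilotDataOfK T.D T.K) pp.1 x) / localDegree T.K (placeOf (pilotDataOfK T.D T.K) pp.1 x))
      (_htq : ∀ (pp : Nat.Primes) (x : (thetaIndex (pilotDataOfK T.D T.K)).Fibre (.inr pp)),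
        haveI : Fact (pp : ℕ).Prime := ⟨pp.2⟩
        Real.log ‖tq pp x‖ = -((pilotDataOfK T.D T.K).qPilot (placeOf (pilotDataOfK T.D T.K) pp.1 x)) *
          logNorm T.K (placeOf (pilotDataOfK T.D T.K) pp.1 x) / localDegree T.K (placeOf (pilotDataOfK T.D T.K) pp.1 x)),
      Thm311ToCor312.Licence
        (settingPrVolSharp (pilotDataOfK T.D T.K) hlog M archPk archSub Ψ act Mmod region n lat sig split qData tq t htq0 htq1) :=
  WRow.licence_triple_unconditional_slot isABCTriple_reyssat (by rw [Cor22.jInv_ratPoint_triple isABCTriple_reyssat]; norm_num) T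
    (fun p => if p = 3 then 4 else if p = 109 then 0 else 2) (fun p => if p = 3 then 5 else if p = 109 then 1 else 1) (WRow.hcell_reyssat_small hl)

/-- **BRANCH C's PER-DATUM ANTECEDENT «∃ ρ qK, QPinned ∧ PilotKummerCompatHull» at every genuine datum over `(ratPoint (2/6436343), l)`,
`l ∈ {151, 157, 163}`** (any columns `col`; every pair of realising Θ- and q-ideles, the CHOSEN ones of the window certificates' `hSHw`/`hSHwBad`
binders included): the per-datum S_H object of the certificates of record (p453137 / p450130 / p447945) HOLDS there, UNCONDITIONALLY.
[cite: Mochizuki2012, IUTchIII Cor. 3.12 Step (xi-d) p. 183, (xi-f) p. 184] [cite: DupuyHilado2025, §3.3, §3.4, §4.9] [claim: Mochizuki2012, status: disputed] -/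
theorem WRow.exists_qPinned_and_hull_reyssat_small (l : ℕ) (hl : l = 151 ∨ l = 157 ∨ l = 163) (T : Cor22.ThetaVolumeDatumAt (ratPoint (((2 : ℕ) : ℚ) / (6436343 : ℕ))) l) :
    letI := T.instFieldF; letI := T.instNumberFieldF; letI := T.instAlgebraF; letI := T.instFieldK
    letI := T.instNumberFieldK; letI := T.instAlgebraK; letI := T.instFieldFbar; letI := T.instAlgebraFbar
    letI := T.instAlgebraKFbar; letI := T.instIsElliptic
    ∀ {logv : PadicLogs T.K} (hlog : LogvAnalytic logv) (M : Type) [Field M] [NumberField M]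
      (archPk : ∀ (j : (thetaIndex (pilotDataOfK T.D T.K)).Label) (vQ : (thetaIndex (pilotDataOfK T.D T.K)).VQ),
        Set ((logShellsDH (pilotDataOfK T.D T.K) logv).Packet j vQ))
      (archSub : ∀ (j : (thetaIndex (pilotDataOfK T.D T.K)).Label) (v : (thetaIndex (pilotDataOfK T.D T.K)).V),
        Set ((logShellsDH (pilotDataOfK T.D T.K) logv).Packet j ((thetaIndex (pilotDataOfK T.D T.K)).over v)))
      (Ψ : ℤ → ∀ v : (thetaIndex (pilotDataOfK T.D T.K)).V, v ∈ (thetaIndex (pilotDataOfK T.D T.K)).Vbad →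
        Set ((logShellsDH (pilotDataOfK T.D T.K) logv).StarPacket v))
      (act : ℤ → ∀ v : (thetaIndex (pilotDataOfK T.D T.K)).V, v ∈ (thetaIndex (pilotDataOfK T.D T.K)).Vbad →
        (logShellsDH (pilotDataOfK T.D T.K) logv).StarPacket v → Module.End ℚ ((logShellsDH (pilotDataOfK T.D T.K) logv).StarPacket v))
      (Mmod : ℤ → ∀ j : (thetaIndex (pilotDataOfK T.D T.K)).LabelStar, Set ((logShellsDH (pilotDataOfK T.D T.K) logv).GlobalPacket j.1))
      (region : ℤ → ∀ j : (thetaIndex (pilotDataOfK T.D T.K)).LabelStar, FinDivisor M → ∀ vQ : (thetaIndex (pilotDataOfK T.D T.K)).VQ,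
        Set ((logShellsDH (pilotDataOfK T.D T.K) logv).Packet j.1 vQ))
      (n : ℤ) {HT : Type} {LogLink : HT → HT → Type} {IsFull : ∀ {s t : HT}, LogLink s t → Prop}
      (lat : LGPGaussianLogThetaLattice LogLink IsFull)
      {Frd : Type} {IsoF : Frd → Frd → Type} {Ob : Frd → Type} {realify : Frd → Frd} {Strip : Type}
      {IsoS : Strip → Strip → Type} {Mv : ∀ v : (thetaIndex (pilotDataOfK T.D T.K)).V, v ∈ (thetaIndex (pilotDataOfK T.D T.K)).Vbad → Type}
      [∀ v h, Monoid (Mv v h)]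
      (sig : GlobalLGPFrobenioidSignature (thetaIndex (pilotDataOfK T.D T.K)).lstar (thetaIndex (pilotDataOfK T.D T.K)).V
        (· ∈ (thetaIndex (pilotDataOfK T.D T.K)).Vbad) Frd IsoF Ob realify Strip IsoS Mv)
      (split : SplittingMonoids Mv) {ObΔ : Type} {N : ∀ v : (thetaIndex (pilotDataOfK T.D T.K)).V, v ∈ (thetaIndex (pilotDataOfK T.D T.K)).Vbad → Type}
      [∀ v h, Monoid (N v h)] (qData : QPilotData ObΔ N)
      (tq : ∀ (pp : Nat.Primes) (x : (thetaIndex (pilotDataOfK T.D T.K)).Fibre (.inr pp)),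
        haveI : Fact (pp : ℕ).Prime := ⟨pp.2⟩; kOf (pilotDataOfK T.D T.K) pp.1 x)
      (t : ∀ (pp : Nat.Primes) (_ : Fin (pilotDataOfK T.D T.K).lstar) (x : (thetaIndex (pilotDataOfK T.D T.K)).Fibre (.inr pp)),
        haveI : Fact (pp : ℕ).Prime := ⟨pp.2⟩; kOf (pilotDataOfK T.D T.K) pp.1 x)
      (htq0 : ∀ pp x, tq pp x ≠ 0)
      (htq1 : ∀ (pp : Nat.Primes) (x : (thetaIndex (pilotDataOfK T.D T.K)).Fibre (.inr pp)),
        haveI : Fact (pp : ℕ).Prime := ⟨pp.2⟩; placeOf (pilotDataOfK T.D T.K) pp.1 x ∉ (pilotDataOfK T.D T.K).S → ‖tq pp x‖ = 1)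
      (col : ℤ → Column (logShellsDH (pilotDataOfK T.D T.K) logv))
      (_ht0 : ∀ pp i x, t pp i x ≠ 0)
      (_ht : ∀ (pp : Nat.Primes) (i : Fin (pilotDataOfK T.D T.K).lstar) (x : (thetaIndex (pilotDataOfK T.D T.K)).Fibre (.inr pp)),
        haveI : Fact (pp : ℕ).Prime := ⟨pp.2⟩
        Real.log ‖t pp i x‖ = -((pilotDataOfK T.D T.K).thetaPilot i (placeOf (pilotDataOfK T.D T.K) pp.1 x)) *
          logNorm T.K (placeOf (pilotDataOfK T.D T.K) pp.1 x) / localDegree T.K (placeOf (pilotDataOfK T.D T.K) pp.1 x))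
      (_htq : ∀ (pp : Nat.Primes) (x : (thetaIndex (pilotDataOfK T.D T.K)).Fibre (.inr pp)),
        haveI : Fact (pp : ℕ).Prime := ⟨pp.2⟩
        Real.log ‖tq pp x‖ = -((pilotDataOfK T.D T.K).qPilot (placeOf (pilotDataOfK T.D T.K) pp.1 x)) *
          logNorm T.K (placeOf (pilotDataOfK T.D T.K) pp.1 x) / localDegree T.K (placeOf (pilotDataOfK T.D T.K) pp.1 x)),
      ∃ (ρ : (∀ v : (thetaIndex (pilotDataOfK T.D T.K)).V, v ∈ (thetaIndex (pilotDataOfK T.D T.K)).Vbad →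
              Set ((logShellsDH (pilotDataOfK T.D T.K) logv).StarPacket v)) →
            ∀ (j : (thetaIndex (pilotDataOfK T.D T.K)).Label) (vQ : (thetaIndex (pilotDataOfK T.D T.K)).VQ),
              Set ((logShellsDH (pilotDataOfK T.D T.K) logv).Packet j vQ))
          (qK : ∀ v : (thetaIndex (pilotDataOfK T.D T.K)).V, v ∈ (thetaIndex (pilotDataOfK T.D T.K)).Vbad →
            Set ((logShellsDH (pilotDataOfK T.D T.K) logv).StarPacket v)),
          QPinned ({ toSituation := situationPrVol (pilotDataOfK T.D T.K) hlog M archPk archSub Ψ act Mmod region, col := col } :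
              LatticeSituation (thetaIndex (pilotDataOfK T.D T.K)))
            (settingPrVolSharp (pilotDataOfK T.D T.K) hlog M archPk archSub Ψ act Mmod region n lat sig split qData tq t htq0 htq1) ρ qK ∧
          PilotKummerCompatHull ({ toSituation := situationPrVol (pilotDataOfK T.D T.K) hlog M archPk archSub Ψ act Mmod region, col := col } :
              LatticeSituation (thetaIndex (pilotDataOfK T.D T.K)))
            (settingPrVolSharp (pilotDataOfK T.D T.K) hlog M archPk archSub Ψ act Mmod region n lat sig split qData tq t htq0 htq1) ρ qK :=
  WRow.exists_qPinned_and_hull_triple_unconditional_slot isABCTriple_reyssat (by rw [Cor22.jInv_ratPoint_triple isABCTriple_reyssat]; norm_num) T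
    (fun p => if p = 3 then 4 else if p = 109 then 0 else 2) (fun p => if p = 3 then 5 else if p = 109 then 1 else 1) (WRow.hcell_reyssat_small hl)

end Summit.ABC.IUTFork.Conditional

end
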